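import Summits.AtomisticToContinuum.FouriersLaw.Theses.EmbeddedDrudeMourre
import Literature.MathematicalPhysics.KineticTheory.InfiniteChainSuperstableDynamics
import HarnessLib

/-!
# Typed companions of `STRATEGY-CENSUS.md` (crux stmt-AtomisticToContinuum-12594, strategist p1) — statements only, no proofs

* `CesaroPowerDecay` — the Hölder/Cesàro MILESTONE (census §Strengthen S⁺₅ / §Decomposition m1): strictly weaker than
  `BmPostKineticTail` on the time side (tolerates non-integrable tails), kills every odd Drude atom (Last 1996), does NOT feed
  `closes` (no density, no positivity). Recorded as the cheapest typed target for any future t = ∞ technology.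
* `TailModuloHighFrequencies` — the weakest tail statement that still yields the crux's WINDOW (census §Decomposition D3):
  far-tail L¹-smallness of `C_T` MINUS a positive-definite remainder whose spectral measure avoids `(−δ₀, δ₀)`. Genuinely weaker
  than `BmPostKineticTail`; rejected as a child because the ι-odd zero-wavenumber sector has no known discrete or singular
  free frequencies away from 0 (no (2,0) classes; (3,1) gapped with bounded van Hove kinks), so the weakening buys nothing known
  while costing the landed glue.
-/

namespace Summit.AtomisticToContinuum.FouriersLaw.Cruxes.MourreDissolution.Census

open MeasureTheory

/-- S⁺₅ / m1: power-law decay of the Cesàro mean square of the canonical current autocorrelation at every small `T`. -/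
def CesaroPowerDecay : Prop :=
  ∀ ω₂ lam β γ : ℝ, 0 < ω₂ → 0 < lam → 0 < β → 0 < γ → ∃ T₀ : ℝ, 0 < T₀ ∧ ∀ T : ℝ, 0 < T → T < T₀ →
    ∃ (μ : MeasureTheory.Measure Literature.MathematicalPhysics.KineticTheory.HeatConduction.ChainConfig)
      (D : Literature.MathematicalPhysics.KineticTheory.HeatConduction.InfiniteChainDynamics
        (Literature.MathematicalPhysics.KineticTheory.HeatConduction.pinnedChain ω₂ lam β γ)),
      (Literature.MathematicalPhysics.KineticTheory.HeatConduction.pinnedChain ω₂ lam β γ).IsChainGibbsMeasure T μ ∧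
      MeasureTheory.MeasurePreserving
        (fun σ : Literature.MathematicalPhysics.KineticTheory.HeatConduction.ChainConfig => fun i : ℤ => σ (i + 1)) μ μ ∧
      D.carrier = (Literature.MathematicalPhysics.KineticTheory.HeatConduction.pinnedChain ω₂ lam β γ).bmGood ∧
      D.PreservesMeasure μ ∧
      ∃ α C : ℝ, 0 < α ∧ 0 < C ∧ ∀ S : ℝ, 1 ≤ S →
        S⁻¹ * ∫ t in (0:ℝ)..S, (D.currentCorrelation μ t) ^ 2 ≤ C * S ^ (-α)

/-- D3: far-tail smallness modulo a positive-definite remainder spectrally supported away from `0` (T-uniform form). -/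
def TailModuloHighFrequencies : Prop :=
  ∀ ω₂ lam β γ : ℝ, 0 < ω₂ → 0 < lam → 0 < β → 0 < γ → ∃ δ₀ : ℝ, 0 < δ₀ ∧ ∀ e : ℝ, 0 < e →
    ∃ M T₀ : ℝ, 0 < M ∧ 0 < T₀ ∧ ∀ T : ℝ, 0 < T → T < T₀ →
      ∃ (μ : MeasureTheory.Measure Literature.MathematicalPhysics.KineticTheory.HeatConduction.ChainConfig)
        (D : Literature.MathematicalPhysics.KineticTheory.HeatConduction.InfiniteChainDynamics
          (Literature.MathematicalPhysics.KineticTheory.HeatConduction.pinnedChain ω₂ lam β γ))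
        (ρ : MeasureTheory.Measure ℝ),
        (Literature.MathematicalPhysics.KineticTheory.HeatConduction.pinnedChain ω₂ lam β γ).IsChainGibbsMeasure T μ ∧
        MeasureTheory.MeasurePreserving
          (fun σ : Literature.MathematicalPhysics.KineticTheory.HeatConduction.ChainConfig => fun i : ℤ => σ (i + 1)) μ μ ∧
        D.carrier = (Literature.MathematicalPhysics.KineticTheory.HeatConduction.pinnedChain ω₂ lam β γ).bmGood ∧
        D.PreservesMeasure μ ∧ MeasureTheory.IsFiniteMeasure ρ ∧ ρ (Set.Ioo (-δ₀) δ₀) = 0 ∧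
        MeasureTheory.IntegrableOn
          (fun t : ℝ => D.currentCorrelation μ t - ∫ ω, Real.cos (ω * t) ∂ρ) (Set.Ioi (M / T ^ 2)) ∧
        ∫ t in Set.Ioi (M / T ^ 2), |D.currentCorrelation μ t - ∫ ω, Real.cos (ω * t) ∂ρ| ≤ e

end Summit.AtomisticToContinuum.FouriersLaw.Cruxes.MourreDissolution.Census
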